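import Summits.QuantumAdvantage.AdviceFreeQNC0.LinFormsJuntaSet
import Literature.Computability.MetaComplexity.TwoModuliExpSums
import Literature.Analysis.Fourier.DiscreteCantorFUPProofs
import HarnessLib

/-!
# Partial orthogonality over the junta subgroup of a system of linear forms (R11' assembly, step (a))

For `K` linear forms `λ : Fin K → Fin n → ℤ/p` and a coordinate set `J`, the dual vectors `γ ∈ (ℤ/p)^K` whose combination
`β(γ) = Σ_j γ_j λ_j` is supported in `J` form a SUBGROUP `Γ_J`; summing the characters `χ_p(⟨γ, x⟩)` over `γ ∈ Γ_J` gives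
`|Γ_J|·[x ∈ Γ_J^⊥]` (`sum_gammaJ_char`).  Hence the cell indicator splits as
`[x = 0] = p^{-K}|Γ_J|·[x ∈ Γ_J^⊥] + p^{-K} Σ_{γ ∉ Γ_J} χ_p(⟨γ,x⟩)` (`ite_eq_zero_split`), separating the junta part (main term,
handled by junta strategies) from the regular part (twisted sums bounded by `TwistBound`) — PROVER3-MEMO-gen9 §4.
WHAT THIS IS NOT: the R11' assembly itself; separation NOT moved.
-/

namespace Summit.QuantumAdvantage.AdviceFreeQNC0

open Finset

namespace LinForms

variable {n K : ℕ} {p : ℕ} [Fact p.Prime]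

/-- The junta subgroup `Γ_J = {γ : β(γ) supported in J}` (as a finset). -/
def gammaJ (lam : Fin K → Fin n → ZMod p) (J : Finset (Fin n)) : Finset (Fin K → ZMod p) :=
  univ.filter fun γ => ∀ i : Fin n, i ∉ J → (∑ j, γ j * lam j i) = 0

/-- Membership in `Γ_J`. -/
theorem mem_gammaJ {lam : Fin K → Fin n → ZMod p} {J : Finset (Fin n)} {γ : Fin K → ZMod p} :
    γ ∈ gammaJ lam J ↔ ∀ i : Fin n, i ∉ J → (∑ j, γ j * lam j i) = 0 := by
  unfold gammaJ; simp

/-- `Γ_J` is closed under addition. -/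
theorem add_mem_gammaJ {lam : Fin K → Fin n → ZMod p} {J : Finset (Fin n)} {γ γ' : Fin K → ZMod p}
    (h : γ ∈ gammaJ lam J) (h' : γ' ∈ gammaJ lam J) : γ + γ' ∈ gammaJ lam J := by
  rw [mem_gammaJ] at h h' ⊢
  intro i hi
  have := congrArg₂ (· + ·) (h i hi) (h' i hi)
  simp only [add_zero] at this
  rw [← this, ← Finset.sum_add_distrib]
  exact Finset.sum_congr rfl fun j _ => by simp [add_mul]

/-- The pairing `⟨γ, x⟩ = Σ_j γ_j x_j`. -/
def dot (γ x : Fin K → ZMod p) : ZMod p := ∑ j, γ j * x j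

/-- The pairing is additive in `γ`. -/
theorem dot_add_left (γ γ' x : Fin K → ZMod p) : dot (γ + γ') x = dot γ x + dot γ' x := by
  unfold dot; rw [← Finset.sum_add_distrib]; exact Finset.sum_congr rfl fun j _ => by simp [add_mul]

/-- **Partial orthogonality**: `Σ_{γ ∈ Γ_J} χ_p(⟨γ,x⟩) = |Γ_J|` if `x ⊥ Γ_J`, and `0` otherwise. -/
theorem sum_gammaJ_char (lam : Fin K → Fin n → ZMod p) (J : Finset (Fin n)) (x : Fin K → ZMod p) :
    (∑ γ ∈ gammaJ lam J, (ZMod.stdAddChar (dot γ x) : ℂ)) =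
      if (∀ γ ∈ gammaJ lam J, dot γ x = 0) then ((gammaJ lam J).card : ℂ) else 0 := by
  classical
  split_ifs with h
  · rw [Finset.sum_congr rfl (fun γ hγ => by rw [h γ hγ, AddChar.map_zero_eq_one]), Finset.sum_const, nsmul_eq_mul, mul_one]
  · push Not at h
    obtain ⟨γ₀, hγ₀, ht⟩ := h
    -- translation by `γ₀` permutes `Γ_J` and multiplies the sum by `χ(⟨γ₀,x⟩) ≠ 1`
    have hneg : ∀ γ ∈ gammaJ lam J, -γ ∈ gammaJ lam J := by
      intro γ hγ
      rw [mem_gammaJ] at hγ ⊢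
      intro i hi
      have h0 := hγ i hi
      calc (∑ j, (-γ) j * lam j i) = -(∑ j, γ j * lam j i) := by
            rw [← Finset.sum_neg_distrib]
            exact Finset.sum_congr rfl fun j _ => by simp [neg_mul]
        _ = 0 := by rw [h0, neg_zero]
    set S := ∑ γ ∈ gammaJ lam J, (ZMod.stdAddChar (dot γ x) : ℂ) with hS
    have hperm : (ZMod.stdAddChar (dot γ₀ x) : ℂ) * S = S := by
      rw [hS, Finset.mul_sum]
      have hf : ∀ γ ∈ gammaJ lam J, (ZMod.stdAddChar (dot γ₀ x) : ℂ) * ZMod.stdAddChar (dot γ x) =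
          ZMod.stdAddChar (dot (γ + γ₀) x) := fun γ _ => by
        rw [dot_add_left, AddChar.map_add_eq_mul, mul_comm]
      rw [Finset.sum_congr rfl hf]
      refine Finset.sum_nbij (fun γ => γ + γ₀) (fun γ hγ => add_mem_gammaJ hγ hγ₀) (fun γ _ γ' _ h => by simpa using h)
        (fun γ hγ => ⟨γ - γ₀, ?_, by simp⟩) (fun γ _ => rfl)
      have h := add_mem_gammaJ (Finset.mem_coe.1 hγ) (hneg γ₀ hγ₀)
      rw [← sub_eq_add_neg] at h
      exact Finset.mem_coe.2 h
    have hne : (ZMod.stdAddChar (dot γ₀ x) : ℂ) ≠ 1 := by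
      rw [Ne, Literature.Analysis.Fourier.stdAddChar_eq_one_iff]; exact ht
    have h0 : ((ZMod.stdAddChar (dot γ₀ x) : ℂ) - 1) * S = 0 := by rw [sub_mul, one_mul, hperm, sub_self]
    rcases mul_eq_zero.1 h0 with h1 | h2
    · exact absurd (sub_eq_zero.1 h1) hne
    · exact h2

/-- **Splitting the point indicator along the junta subgroup**:
`[x = 0] = p^{-K}|Γ_J|·[x ⊥ Γ_J] + p^{-K} Σ_{γ ∉ Γ_J} χ_p(⟨γ,x⟩)`. -/
theorem ite_eq_zero_split (lam : Fin K → Fin n → ZMod p) (J : Finset (Fin n)) (x : Fin K → ZMod p) :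
    (if x = 0 then (1 : ℂ) else 0) =
      ((p : ℂ) ^ K)⁻¹ * ((gammaJ lam J).card : ℂ) * (if (∀ γ ∈ gammaJ lam J, dot γ x = 0) then (1 : ℂ) else 0) +
      ((p : ℂ) ^ K)⁻¹ * ∑ γ ∈ univ.filter (fun γ => γ ∉ gammaJ lam J), (ZMod.stdAddChar (dot γ x) : ℂ) := by
  classical
  have hfull := Literature.Computability.MetaComplexity.TwoModuli.sum_stdAddChar_dot_eq_ite (p := p) x
  have hsplit : (∑ γ : Fin K → ZMod p, (ZMod.stdAddChar (∑ j, γ j * x j) : ℂ)) =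
      (∑ γ ∈ gammaJ lam J, (ZMod.stdAddChar (dot γ x) : ℂ)) +
      ∑ γ ∈ univ.filter (fun γ => γ ∉ gammaJ lam J), (ZMod.stdAddChar (dot γ x) : ℂ) := by
    rw [← Finset.sum_filter_add_sum_filter_not univ (fun γ => γ ∈ gammaJ lam J), Finset.filter_univ_mem]
    rfl
  rw [hsplit, sum_gammaJ_char] at hfull
  have hpK : ((p : ℂ) ^ K) ≠ 0 := pow_ne_zero _ (by exact_mod_cast (Fact.out : p.Prime).ne_zero)
  -- solve for the indicator
  have key : (if x = 0 then (1 : ℂ) else 0) = ((p : ℂ) ^ K)⁻¹ * (if x = 0 then ((p : ℂ) ^ K) else 0) := by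
    split_ifs
    · field_simp
    · simp
  rw [key, ← hfull]
  split_ifs <;> ring

end LinForms

end Summit.QuantumAdvantage.AdviceFreeQNC0
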